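import Summits.HubbardSuperconductivity.HubbardSuperconductivity.Theses.ParityGapRigidity
import Summits.HubbardSuperconductivity.HubbardSuperconductivity.Theorems.ParityGapRigidityGappedWindowStubVarianceOfClustering
import Literature.MathematicalPhysics.QuantumLattice.HubbardWave0LiebProofs
import Literature.MathematicalPhysics.QuantumLattice.FermionOperatorsProofs

/-!
# Birth skeleton (BC3) for the crux `ParityGapRigidity.GappedWindow`
(item stmt-HubbardSuperconductivity-2196; route route-HubbardSuperconductivity-ParityGapRigidity, crux of rank 3) —
skeleton registrar planner-skel-stmt-HubbardSuperconductivity-2196-0, 2026-08-17.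

The crux (`Summit.HubbardSuperconductivity.HubbardSuperconductivity.Theses.ParityGapRigidity.GappedWindow`):
the PURE `t' = 0` repulsive Hubbard model owns a window — some `U > 0`, `δ ∈ (0, 1/2)` — in which, uniformly in the
even torus side `L ≥ L₀` and for every normalised `(N_L, S^z = 0)`-sector ground state, `N_L = 2⌊(1-δ)L²/2⌋`:
(PG) Matveev–Larkin parity gap `E(N_L+1) + E(N_L-1) - 2E₀(N_L,0) ≥ 2Δ > 0` (energies only);
(H2) normal fluctuations `Var_ψ(A) ≤ C·L²` of every particle–hole bilinear `A = Σ a(p) c†_{p₁} c_{p₂}`, `|a| ≤ 1`,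
supported on pairs at torus distance `≤ 1`; (H3) at most `D` levels of the sector below `E₀ + c/L`;
(H4) even-step staircase curvature `E(N_L±2) - ½[E(N_L) + E(N_L±4)] ≤ C/L²`; (DOM) `d`-wave dominance
`κ·L²·Re v†ρ₂(ψ)v ≤ Re⟨ψ, Δ_d†Δ_d ψ⟩` for every unit pair wavefunction `v`.

## The seam: EXISTENCE of a gapped clustering window × IDENTITY of the pair channel × KINEMATICS

All five clauses share ONE existential window, so no cut can distribute them over independent existence claims.
The line cuts instead by the KIND of statement, along the seam a constructive solution of the window would follow:

* `stub_gappedClusteringWindow` (S — existence; the model-specific residue, size XL, channel-agnostic).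
  ∃ `U > 0`, `δ ∈ (0,1/2)` with, uniformly in even `L ≥ L₀`: the three ENERGIES-ONLY clauses (PG), (H3), (H4)
  verbatim, and (CL) EXPONENTIAL CLUSTERING of the connected correlations of nearest-neighbour particle–hole
  bilinears in every normalised sector ground state,
  `|⟨B_p† B_q⟩_ψ - conj⟨B_p⟩_ψ ⟨B_q⟩_ψ| ≤ C e^{-m·dist(p,q)}`, `B_p = c†_{p₁} c_{p₂}` — the standard OUTPUT of
  a convergent expansion / quasi-adiabatic continuation (and what ED/DMRG measure), of which (H2) is a corollary.
  (CL) is compatible with pair condensation: the ODLRO correlator `c†c†cc` (pair at `x` vs pair at `y`) is not of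
  the form `B_p† B_q`; in a fully gapped singlet superconductor the `B_p† B_q` connected function is a sum of
  normal × normal and anomalous × anomalous contractions, both decaying on the scale `ξ`. (CL) FAILS for
  ferromagnets (transverse spin correlations are connected correlations of on-site spin-flip bilinears, distance 0),
  stripes / density waves / phase separation (density bilinears) — so S already excludes them, as (H2) must.
  No `d`-wave word occurs in S: it says "somewhere the pure model is fully one-particle gapped, spectrally rigid in
  its sector, locally convex in `N` at even steps, and clustering".
* `stub_dWaveChannelPinning` (Y — identity of the channel; universal over the phase diagram, size L–XL).
  For EVERY `U > 0`, `δ ∈ (0,1/2)`: (PG) ∧ (H3) ∧ (H4) ∧ (CL) ⇒ (DOM) — every gapped clustering point of the pure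
  model is `d`-wave dominated: the extended nearest-neighbour `B₁g` pair mode `φ_d` (`‖φ_d‖² = 4L²`,
  `⟨Δ_d†Δ_d⟩ = φ_d†ρ₂φ_d`) captures a fixed fraction of the top of the pair spectrum,
  `λ_max(ρ₂(ψ)) ≤ (8/κ)·φ̂_d†ρ₂(ψ)φ̂_d`. Two regimes, both believed: without ODLRO `λ_max = O(1)` and (DOM) is
  the extensive floor `⟨Δ_d†Δ_d⟩ ≥ ϱL²` on the nearest-neighbour singlet bond density (false only for saturated ferromagnets, which
  fail (CL), or exotic states with no n.n. singlet weight); with ODLRO it says the condensate wavefunction has a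
  non-zero nearest-neighbour `B₁g` component — true for `d_{x²-y²}` and for chiral `d + id′`, FALSE for a pure
  `d_xy`, extended-`s` or triplet condensate. (PG) removes the nodal `d_xy` / `d_{x²-y²}` and Fermi-liquid
  regimes (gap `≲ v_Δ/L`), (H3) removes every `SU(2)`-breaking state (triplet condensates, (anti)ferromagnets:
  Anderson tower `S(S+1)/(2χL²)` puts `~√L` sector levels below `c/L`), (CL) removes density waves. This is where
  "d-wave" enters the crux; why it might fail: a fully gapped extended-`s` (A₁g) singlet window, or a `B₁g`
  condensate carried by longer bonds with vanishing n.n. weight, somewhere in `0 < δ < 1/2` of the pure model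
  (none is believed to exist for on-site repulsion at `t' = 0`: RaghuKivelsonScalapino2010, ArovasBergKivelsonRaghu2022 §9).
* `stub_varianceOfClustering` (K — kinematics; TRUE, provable now, size M). (Birth text; see Reshape r1 below
  for the registered form with a summable profile `F` in place of `(C, m)`.) For all `C` and `m > 0` there is
  `C' = C'(C, m)` such that on EVERY torus side `L` and for EVERY Fock vector `ψ` (no normalisation, no
  Hamiltonian): (CL) with constants `(C, m)` ⇒ the (H2) inequality with constant `C'`. Proof in print: expand
  `Var_ψ(A) = Σ_{p,q} conj(a p) a q [⟨B_p†B_q⟩ - conj⟨B_p⟩⟨B_q⟩]` (linearity of `expect`, `(Σ a•B)ᴴ = Σ conj a • Bᴴ`),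
  bound by `Σ_{p,q supported} C e^{-m d(p,q)}`; at most `36` supported orbital pairs per site (`≤ 9` sites within
  `ℓ^∞` torus distance `1`, `2×2` spins), and `Σ_y e^{-m·dist(x,y)} ≤ Σ_{r<L} 4(2r+1) e^{-mr} ≤ S(m) < ∞` on
  `(ℤ/Lℤ)²` uniformly in `L` (in tree: `sum_radial_le` + `card_filter_torusDist_eq_le`, sphere count
  `≤ d·2(2r+1)^{d-1}`, `LatticeToriProofs`), so `Var ≤ 36²·4·max(C,0)·S(m)·L²`.

`GappedWindow_of : Sig.stub_gappedClusteringWindow → Sig.stub_dWaveChannelPinning → Sig.stub_varianceOfClustering →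
GappedWindow` concludes the route decl BY NAME and is proved sorry-free: S gives the window with (PG), (H3), (H4),
(CL); Y turns that gapped clustering point into (DOM); K turns the clustering constants `(C, m)` of (CL) into ONE
variance constant `C'`, uniform in `L` because it depends on `(C, m)` only, which is (H2). `GappedWindow_proof :
GappedWindow` is the skeleton in its final shape (depends on `sorryAx` through the three stubs only).

## Reshape r1 (line lead prover-line-stmt-HubbardSuperconductivity-2196-0, 2026-08-17): summable-profile clustering

The birth skeleton stated (CL) with an EXPONENTIAL profile `C e^{-m·dist}` for ALL nearest-neighbour bilinears,
density `n_x = B_{(x,x)}` included. At the only candidate window (a superconductor of the NEUTRAL lattice model)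
this is believed false: the fixed-`N` ground state of a neutral superfluid carries a gapless Anderson–Bogoliubov
phonon `ω_k ≈ c_s |k|`, the static structure factor is `S(k) ∝ |k|` at small `k` (Feynman / f-sum rule), and the
connected density–density correlation therefore decays only like `dist^{-(d+1)} = dist^{-3}` — a power law, not an
exponential (the registrar's mean-field Wick argument misses the collective mode). With the exponential format S
would be false wherever the crux wants it true and Y vacuous: the line would be dead on arrival for a reason that
has nothing to do with the crux ((H2) = `Var ≤ C L²` only needs SUMMABLE connected correlations, and `dist^{-3}`
is summable on `ℤ²`). Reshape r1 therefore replaces the pair of constants `(C, m)` by ONE radial profile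
`F : ℕ → ℝ` with `IsSummableProfile F` (`F ≥ 0`, `Σ_r (2r+1) F(r) < ∞`): `ClustersWith F ψ`,
`BilinearClusteringAt U δ := ∃ F, IsSummableProfile F ∧ …`, and K becomes `∀ F, IsSummableProfile F → ∃ C', ∀ L ψ,
ClustersWith F ψ → VarianceBound C' ψ` (same proof: `Σ_y F(dist(x,y)) ≤ Σ_{r<L} 4(2r+1) F(r) ≤ 4 S_F`). The
exponential window implies the reshaped one (`C e^{-mr}`, `C ≥ 0`, `m > 0`, is a summable profile), so nothing the
birth line could prove is lost; S is now plausible at a chiral `d + id′` point and Y keeps its content. The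
composition `GappedWindow_of` is unchanged in shape. Stub NAMES are unchanged; signatures of S, Y (through
`GappedClusteringPoint`) and K changed and were re-registered (`ledger skeleton check`).

## Integration r2 (line lead prover-line-stmt-HubbardSuperconductivity-2196-c1-0, 2026-08-17): K closed

Wave 1 of the continuation lead landed stub K verbatim as
`Summit.HubbardSuperconductivity.GappedWindow.Birth.stub_varianceOfClustering` (p147553, ACCEPTED, 316 lines incl. reusable
helpers `variance_eq_re_sum`, `re_variance_le`, `sum_orb_profile_le`, …); the skeleton imports it and the `stub_*` theorem
below is now a one-line reference (no `sorry`); the composition `GappedWindow_of` takes S and Y only and uses K as a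
lemma (`sig_stub_varianceOfClustering`). Open stubs: S (`stub_gappedClusteringWindow`, the existence residue) and
Y (`stub_dWaveChannelPinning`, channel pinning) — both reported by wave 1 as honest open physics claims with no in-tree or
in-print handle (no definitional degeneracy: for `L ≥ 2`, `N_L ± 1, N_L ± 4 ≤ 2L²`, `szSector N_L 0 ≠ ⊥`; DOM is not
kinematic — the `S = N/2, S^z = 0` sector vector has `Δ_d ψ = 0`, `ρ₂ ≠ 0`). Signatures unchanged; no reshape.

## Audit r3 (line lead prover-line-stmt-HubbardSuperconductivity-2196-c2-0, 2026-08-17): no provable residue left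

Continuation lead c2 re-audited S and Y at the Lean level and against the exact structure of `hubbardTorus`; no stub
moved, no reshape (signatures and sha of the stub block unchanged; this paragraph is the only edit).
(1) Definitions (`hamiltonian`, `groundEnergy` = `sInf` over normalised `N`-particle vectors, `Matrix.minEnergyOn` =
`sInf` over the sector, `IsGroundStateInSector` = exact eigenvector at that value, `twoParticleRDM`, `pairField`):
for `L ≥ 2` every sector met by S (`N_L, N_L ± 1, N_L ± 2, N_L ± 4 ≤ 2L²`, `szSector N_L 0 ≠ ⊥`) is non-empty, so no
junk value (`sInf ∅ = 0`) and no truncated subtraction can make S or the crux true or false cheaply.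
(2) Exact symmetries give no refutation of (PG) ∧ (H3) ∧ (H4): Yang's η-pairing (`[H, η†] = U η†`, momentum `(π,π)`,
even `L`) only yields `E(N+2) ≤ E(N) + U` below half filling; the bipartite particle–hole map relates `N ↔ 2L² - N`;
Lieb–Schultz–Mattis/Hastings flux insertion bounds the INTRA-sector gap by `C log L / L`, compatible with (H3) for
`c < 2π c_s` (phonon) and `D ≥ 2`; Koma–Tasaki towers live in `N ± 2k` (allowed by (H4)). All clauses are mutually
consistent at a fully gapped SINGLET superconducting point, so neither S nor `¬S` is in reach of any in-tree or
in-print theorem: S is the open problem "the pure 2D Hubbard model has a fully one-particle-gapped, spectrally rigid,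
clustering window", nothing less.
(3) Location constraint the clauses put on the only candidate (recorded for the disprover and for route ChiralWindow,
whose crossing line `δ*(U)` is the same object): (H3) excludes every SU(2)-breaking state (Anderson tower
`S(S+1)/(2χL²)` puts `~√L` levels of the `S^z = 0` sector below `E₀ + c/L`), so the Kohn–Luttinger partner `χ*` of
`B₁g` on the crossing line must be a node-covering SINGLET channel (`B₂g = d_xy` or `A₁g`); a triplet `E`-irrep
partner gives `d + ip`, which fails (H3), and `A₂g` fails node covering (hence (PG)). At strictly `U → 0`, `t' = 0`,
the neighbour of `d_{x²-y²}` below half filling is the triplet `p⁽⁶⁾ = p′` pocket at `0.5 < n < 0.6` (SimkovicEtAl2016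
§3.1, arXiv:1512.04271 pp. 7–8; DengEtAl2015, arXiv:1408.2088 p. 2), which vanishes at `U ≳ 0.08`, above which a
near-vertical SINGLET `d_xy / d_{x²-y²}` boundary sits at `n ≈ 0.6` for `0.08 ≲ U ≤ 4` (DengEtAl2015 Fig. 1, bold
diagrammatic Monte Carlo, controlled for `U ≤ 4`, `n < 0.7`). So S has NO candidate in the asymptotic `U → 0` regime;
its only candidate is a `d + id′` coexistence sliver on that boundary, `δ ≈ 0.4`, `0.08 ≲ U ≲ 4`, where the measured
Cooper couplings are `λ ≤ 0.1` (DengEtAl2015): gap `Δ/E_F ≲ e^{-1/λ} ≈ e^{-10} ≈ 5·10⁻⁵` and `L₀ ≳ ξ/a ≳ 2·10⁴`.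
Consequence in numbers: at every side reachable by ED/DMRG (`L ≤ 16 ≪ ξ`) the candidate looks like a Fermi liquid with
shell-dominated `E(N±1)`, so the crux is neither provable (no expansion is controlled at finite `U`; Barriers:
WeakCouplingCeiling bites fully) nor numerically falsifiable AT ITS CANDIDATE; numerics can only exclude OTHER windows.
(4) Y is not kinematic even given (CL) and the sector — now MACHINE-CHECKED in this file (Appendix Y′,
`NonKinematic.dominance_not_kinematic_at`, sorry-free, axioms {propext, Classical.choice, Quot.sound}): for even
`L ≥ 2`, `0 < δ < 1/2` and every `κ > 0` there is a normalised `ψ ∈ szSector N_L 0` clustering with the summable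
profile `2·1_{r=0}` on which `∀ unit v, κL²·Re v†ρ₂(ψ)v ≤ Re⟨Δ_d†Δ_d⟩_ψ` fails. The witness: `A` an
`N_L/2`-subset of the even checkerboard sublattice `{x : x₀ + x₁ even}` of `(ℤ/Lℤ)²` (`N_L/2 ≤ L²/2 = #sublattice`,
`NonKinematic.two_mul_card_evenSub`) and `ψ = |s⟩` the occupation basis vector with `s = A × {↑, ↓}` (every site
of `A` doubly occupied). On a basis vector `⟨s|c†_i c_j c†_k c_l|s⟩ ≠ 0` forces `{i, k} = {j, l}`
(`expect_four_basisVec_eq_zero`), so the connected correlation of `B_p = c†_{p₁}c_{p₂}` and `B_q` vanishes unless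
`p₁ = q₁` (`connected_eq_zero`); every unit step joins opposite sublattices on an even torus
(`parity_add_proj_unitStep`) and the `e = 0` term of `localPair` carries `dWaveFormFactor 0 = 0`, so
`Δ_d ψ = 0` (`pairField_mulVec_wit`); and `v = δ_{((x,↑),(x,↓))}`, `x ∈ A`, has `v†ρ₂(ψ)v = ⟨n_{x↑}n_{x↓}⟩ = 1`
(`expect_rho2_diag_basisVec`). So no hypothesis of the (CL)/(H2) type can discharge Y: the ground-state property
at a point where (PG), (H3), (H4) hold is essential — a channel-selection statement with no theorem in print
(c1's wave-1 witness, the `S = N/2` member of the sector, shows non-kinematicity without (CL), which it violates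
by ferromagnetic order).
Outcome of lead c2: `promote-stub` S again (Y is conjecture-sized as well); recommendation to the planner: carry
`GappedWindow` (equivalently S ∧ Y, or the crux with (H2) replaced by (CL)) as ONE physics-conjecture leaf shared with
route ChiralWindow's window, and do not re-seat prover leads on this line — after K nothing provable remains.

## Quantitative envelope of the window (leads c4–c6, 2026-08-17; c5 cycle 2 and c6 add the last two bullets): what IS proved about S's parity gap

No stub moved in leads c3–c5 (line verdict `line-dead` at S, twice; the stub block below is byte-identical to r3);
what the last two seats landed instead is the a-priori ENVELOPE every witness `(U, δ, Δ, L₀)` of the (PG) clause of S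
(equivalently of the crux) must satisfy — all sorry-free, standard axioms, in the tree:
* `U = 0` calibration (c4): (PG) is FALSE at the free point for every `δ ∈ (0, 1)` (open shells along even `L`;
  `Theorems/ParityGapRigidityZeroCouplingParityGap`, p156730), (H3) is FALSE there (flat columns give `> D` levels
  within `c/L`; `…ZeroCouplingLevelCount`), (H4) is TRUE there with `C = 0` (`…ZeroCouplingStaircase`, p157003);
* weak-coupling ceiling (c4): `PG ≤ 4π/L + 4|U|/√(1-δ)` for every sector ground state, any real `U`
  (`Literature/…/HubbardParityGapCeiling`, p158583), hence **`Δ ≤ 2U/√(1-δ)`** (`Theorems/ParityGapRigidityParityGapCeiling`);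
* strong-coupling ceiling (c5): the Gutzwiller-projected creation operator `(1 - n_{z↓})c†_{z↑}` COMMUTES with the
  repulsion (`Literature/…/HubbardProjectedCreationCommutator`, p163540), so adding an electron costs at most
  `12·L/√(L² - N)` hopping units for EVERY `U` (projected trial states averaged over the sites, weight = number of
  empty sites `≥ δL²`), and for `U ≥ 0` removing one at the best site costs at most `4` — removal never raises
  `Σ n↑n↓` (`Literature/…/HubbardProjectedOneParticleCost`, p164194); hence `PG ≤ 4 + 12/√δ` for all large `L` and
  **`Δ ≤ 2 + 6/√δ` whatever the coupling** (`Literature/…/HubbardParityGapCeilingStrongCoupling`, p164514;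
  crux corollaries `Theorems/ParityGapRigidityStrongCouplingCeiling`).
So **`Δ ≤ min(2U/√(1-δ), 2 + 6/√δ)`**: a window of the pure repulsive model is neither a free-point phenomenon nor
a Mott-scale one — its one-particle gap is `O(U)` at weak and `O(t)` at strong coupling; at the Kohn–Luttinger
candidate `δ ≈ 0.4` the envelope is `Δ ≤ min(2.6·U, 11.5)` (believed truth there: `Δ ~ e^{-10}`, c2 §(3)). The kill
criterion `NoUniformParityGap` is a THEOREM outside this envelope (`noUniformParityGap_above_ceiling`,
`noUniformParityGap_above_strongCouplingCeiling`); its open content is exactly `0 < Δ ≤ min(2U/√(1-δ), 2 + 6/√δ)`.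
* no Fermi-surface jump (c5, cycle 2): `ParityGapClustering` (stmt-2197) is now PROVED, so (PG) ⇒ (H1) unconditionally,
  and clustering of `ρ₁` makes the momentum distribution `n_σ(k) = ⟨c†_{kσ}c_{kσ}⟩` L-uniformly Lipschitz:
  **`|n_σ(k) - n_σ(k')| ≤ K(U,Δ)·dist(k,k')/L`** for every sector ground state in the window
  (`Literature/…/MomentumDistributionLipschitz`, p166225; `Theorems/ParityGapRigidityMomentumDistribution`, p166778:
  `gappedWindow_momentumDistribution_lipschitz`, and the contrapositive `not_parityGap_clause_of_fermiJump` — a Migdal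
  jump `z > 0` between momenta at dual distance `≤ 1` along infinitely many even `L` proves the kill criterion at `(U, δ)`).
  A Landau quasiparticle residue kills every window, whatever (H2)–(H4), (DOM); at the Kohn–Luttinger candidate
  `K ~ v_F/Δ ~ e^{+c/U²}`, so the window's threshold must satisfy `L₀ ≳ K`.
* parity gap × momentum smearing ≤ coupling × doublon deficit (c6): the EXACT mode identity behind every
  one-particle variational bound — `(E(2n+1)+E(2n-1)-2E)·n_k(1-n_k) ≤ U·(n·n_k/L² - β_k)`,
  `β_k = Re⟨ψ, T_k c_{k↑} ψ⟩`, `{c_{k↑}, T_k} = L⁻²N̂_↓` — summed over the zone with `Σ_k T_k c_{k↑} = Σ_z n_{z↑}n_{z↓}`: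
  **`PG · Σ_k n_k(1-n_k) ≤ U · (n²/L² - ⟨Σ_z n_{z↑}n_{z↓}⟩_ψ)`** for every unit sector ground state, any real `U`
  (`Literature/…/HubbardParityGapDoublonDeficit`, p172680; `Theorems/ParityGapRigidityDoublonDeficit`, p172879). So no
  `O(U²)` ceiling can come from one-particle trial states (the doublon deficit has the permitting sign), and with the
  no-Fermi-jump bullet and a discrete `ℓ¹`-Poincaré inequality on the dual torus (`Literature/Probability/LatticeModels/
  TorusL1Poincare`, p173177) the smearing of a window is extensive, `Σ_k n_k(1-n_k) ≥ s₀L²`, hence **every window of the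
  repulsive model has an extensive doublon deficit, `⟨Σ_z n_{z↑}n_{z↓}⟩_ψ ≤ n_L²/L² - d₀L²`, `d₀ = d₀(U,Δ,δ) > 0`**
  (`Theorems/ParityGapRigidityDoublonDeficitExtensive`, p173281: `smearing_extensive_of_parityGap_clause`,
  `doublonDeficit_extensive_of_parityGap_clause`, `gappedWindow_doublonDeficit_extensive`, kill-criterion instrument
  `not_parityGap_clause_of_doublonWick`). No uniform parity gap in any asymptotically doublon-uncorrelated regime.

## Disproof used / dead lines / negatives

`ledger crux ls stmt-HubbardSuperconductivity-2196` (2026-08-17T09:05Z, lead c2): Lines/birth.lean, Lines/birth.md,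
PICKED.md only — still no `Disproof.lean`, no dead lines, no crux ideas. At registration: no workfiles (no `Disproof.lean`, no dead
lines, no ideas). `ledger negatives --problem HubbardSuperconductivity` (2026-08-17): 2 refuted statements
(CooperPairDMottWalk `not_breathingSelfDual`, AposterioriCapRg `KlsOrderOpenness_refuted`) — neither equal nor
trivially equivalent to any stub. Route kill criterion `NoUniformParityGap` (support r9) negates the (PG) clause of
S for all `(U, δ)`: its proof kills S (and the crux), as intended by the route.

## BC3 audit (this seat; raw outputs in the seat's NOTES.md `birth-certificate:`)

`lean check --json` rc 0 with `sorry` exactly in `stub_gappedClusteringWindow`, `stub_dWaveChannelPinning`,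
`stub_varianceOfClustering` (sorry count 3 = stub count, zero elsewhere); probes `stub → GappedWindow` and
`stub → HubbardSuperconductivity` by `first | exact? | simpa [stub] | (unfold stub; simpa) | aesop` FAIL for all
three stubs (6/6), file `bc/GappedWindow_stub_probes.lean` of the seat folder.
-/

set_option linter.dupNamespace false

noncomputable section

namespace Summit.HubbardSuperconductivity.HubbardSuperconductivity.Cruxes.GappedWindow.Birth

open Literature.MathematicalPhysics.QuantumLattice
open Summit.HubbardSuperconductivity.HubbardSuperconductivity.Theses.ParityGapRigidity

/-! ### The five clauses of the crux at a parameter point `(U, δ)` (bodies verbatim from the route decl) -/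

/-- (PG) uniform Matveev–Larkin parity gap at `(U, δ)`: `2Δ ≤ E(N_L+1) + E(N_L-1) - 2E₀(N_L, 0)` for all even
`L ≥ L₀` (first conjunct of `GappedWindow`, verbatim). -/
def ParityGapAt (U δ : ℝ) : Prop :=
  ∃ Δ : ℝ, 0 < Δ ∧ ∃ L₀ : ℕ, ∀ L ≥ L₀, Even L → ∀ Hm, Hm = hubbardTorus 2 L 1 U →
    2 * Δ ≤ groundEnergy Hm (2 * ⌊(1 - δ) * (L : ℝ) ^ 2 / 2⌋₊ + 1) +
      groundEnergy Hm (2 * ⌊(1 - δ) * (L : ℝ) ^ 2 / 2⌋₊ - 1) -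
        2 * Matrix.minEnergyOn Hm (szSector (2 * ⌊(1 - δ) * (L : ℝ) ^ 2 / 2⌋₊) 0)

/-- The (H2) inequality for ONE state `ψ` on the torus of side `L` with constant `C`: every particle–hole bilinear
`A = Σ_p a(p) c†_{p₁} c_{p₂}` with `|a| ≤ 1` supported on orbital pairs at torus distance `≤ 1` has
`Re⟨Aᴴ A⟩_ψ - |⟨A⟩_ψ|² ≤ C·L²` (the inner clause of the second conjunct of `GappedWindow`, verbatim). -/
def VarianceBound {L : ℕ} (C : ℝ) (ψ : Fock (Orb (FermionTorus 2 L))) : Prop :=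
  ∀ a : Orb (FermionTorus 2 L) × Orb (FermionTorus 2 L) → ℂ, (∀ p, ‖a p‖ ≤ 1) →
    (∀ p, a p ≠ 0 → torusDist (ofLex p.1).1.toTorusSite (ofLex p.2).1.toTorusSite ≤ 1) →
      (expect (Matrix.conjTranspose (∑ p, a p • (creation p.1 * annihilation p.2)) *
          (∑ p, a p • (creation p.1 * annihilation p.2))) ψ).re -
        ‖expect (∑ p, a p • (creation p.1 * annihilation p.2)) ψ‖ ^ 2 ≤ C * (L : ℝ) ^ 2

/-- (H2) normal fluctuations at `(U, δ)`: one constant `C` for all even `L ≥ L₀` and all normalised sector ground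
states (second conjunct of `GappedWindow`; its inner clause is `VarianceBound C ψ`). -/
def NormalFluctuationsAt (U δ : ℝ) : Prop :=
  ∃ C : ℝ, ∃ L₀ : ℕ, ∀ L ≥ L₀, Even L → ∀ Hm, Hm = hubbardTorus 2 L 1 U → ∀ ψ,
    IsGroundStateInSector Hm (2 * ⌊(1 - δ) * (L : ℝ) ^ 2 / 2⌋₊) 0 ψ → star ψ ⬝ᵥ ψ = 1 → VarianceBound C ψ

/-- (H3) level count at `(U, δ)`: at most `D` levels of the `(N_L, 0)` sector below `E₀ + c/L`
(third conjunct of `GappedWindow`, verbatim). -/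
def LevelCountAt (U δ : ℝ) : Prop :=
  ∃ c : ℝ, 0 < c ∧ ∃ D L₀ : ℕ, ∀ L ≥ L₀, Even L → ∀ Hm, Hm = hubbardTorus 2 L 1 U →
    ∀ V : Submodule ℂ (Fock (Orb (FermionTorus 2 L))), V ≤ szSector (2 * ⌊(1 - δ) * (L : ℝ) ^ 2 / 2⌋₊) 0 →
      (∀ φ ∈ V, (star φ ⬝ᵥ Matrix.mulVec Hm φ).re ≤
        (Matrix.minEnergyOn Hm (szSector (2 * ⌊(1 - δ) * (L : ℝ) ^ 2 / 2⌋₊) 0) + c / (L : ℝ)) *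
          (star φ ⬝ᵥ φ).re) → Module.finrank ℂ V ≤ D

/-- (H4) even-step staircase curvature at `(U, δ)`: `E(N_L±2) - ½[E(N_L) + E(N_L±4)] ≤ C/L²`
(fourth conjunct of `GappedWindow`, verbatim). -/
def StaircaseCurvatureAt (U δ : ℝ) : Prop :=
  ∃ C : ℝ, ∃ L₀ : ℕ, ∀ L ≥ L₀, Even L → ∀ Hm, Hm = hubbardTorus 2 L 1 U → ∀ (E : ℕ → ℝ) (n : ℕ),
    E = groundEnergy Hm → n = 2 * ⌊(1 - δ) * (L : ℝ) ^ 2 / 2⌋₊ →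
      E (n + 2) - (E n + E (n + 4)) / 2 ≤ C / (L : ℝ) ^ 2 ∧ E (n - 2) - (E n + E (n - 4)) / 2 ≤ C / (L : ℝ) ^ 2

/-- (DOM) `d`-wave dominance at `(U, δ)`: `κ·L²·Re v†ρ₂(ψ)v ≤ Re⟨ψ, Δ_d†Δ_d ψ⟩` for every unit `v` and every
normalised sector ground state, even `L ≥ L₀` (fifth conjunct of `GappedWindow`, verbatim). -/
def DWaveDominanceAt (U δ : ℝ) : Prop :=
  ∃ κ : ℝ, 0 < κ ∧ ∃ L₀ : ℕ, ∀ (L : ℕ) [NeZero L], L₀ ≤ L → Even L → ∀ Hm, Hm = hubbardTorus 2 L 1 U → ∀ ψ,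
    IsGroundStateInSector Hm (2 * ⌊(1 - δ) * (L : ℝ) ^ 2 / 2⌋₊) 0 ψ → star ψ ⬝ᵥ ψ = 1 →
      ∀ v : Orb (FermionTorus 2 L) × Orb (FermionTorus 2 L) → ℂ, star v ⬝ᵥ v = 1 →
        κ * (L : ℝ) ^ 2 * (star v ⬝ᵥ Matrix.mulVec (twoParticleRDM ψ) v).re ≤
          (expect (Matrix.conjTranspose (pairField dWaveFormFactor L) * pairField dWaveFormFactor L) ψ).re

/-! ### Vocabulary of the seam -/

/-- The particle–hole bilinear `B_p = c†_{p₁} c_{p₂}` of an ordered orbital pair `p`. -/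
def bilin {L : ℕ} (p : Orb (FermionTorus 2 L) × Orb (FermionTorus 2 L)) :
    Matrix (Finset (Orb (FermionTorus 2 L))) (Finset (Orb (FermionTorus 2 L))) ℂ :=
  creation p.1 * annihilation p.2

/-- An orbital pair is nearest-neighbour supported: its two sites are at torus distance `≤ 1`
(the support condition of (H2)). -/
def NNSupported {L : ℕ} (p : Orb (FermionTorus 2 L) × Orb (FermionTorus 2 L)) : Prop :=
  torusDist (ofLex p.1).1.toTorusSite (ofLex p.2).1.toTorusSite ≤ 1

/-- A SUMMABLE RADIAL PROFILE on `ℤ²`-like tori: `F ≥ 0` with `Σ_r (2r+1)·F(r) < ∞` (so that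
`Σ_y F(dist(x,y)) ≤ 4·Σ_r (2r+1) F(r)` on every `(ℤ/Lℤ)²`, uniformly in `L`, by the sphere count
`#{u : dist(u,y) = r} ≤ 4(2r+1)` of `card_filter_torusDist_eq_le`). Exponential profiles `C e^{-m r}` (`C ≥ 0`,
`m > 0`) and power laws `C (1+r)^{-p}`, `p > 2`, are summable profiles. (Reshape r1 of the lead, 2026-08-17:
replaces the exponential-only clustering format of the birth skeleton — see the module docstring.) -/
def IsSummableProfile (F : ℕ → ℝ) : Prop :=
  (∀ r, 0 ≤ F r) ∧ Summable fun r : ℕ => (2 * (r : ℝ) + 1) * F r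

/-- (CL) for ONE state with radial profile `F`: clustering, in the torus distance between the base sites, of
the connected correlations of nearest-neighbour particle–hole bilinears,
`|⟨B_p† B_q⟩_ψ - conj⟨B_p⟩_ψ·⟨B_q⟩_ψ| ≤ F(dist(p₁, q₁))`. -/
def ClustersWith {L : ℕ} (F : ℕ → ℝ) (ψ : Fock (Orb (FermionTorus 2 L))) : Prop :=
  ∀ p q : Orb (FermionTorus 2 L) × Orb (FermionTorus 2 L), NNSupported p → NNSupported q →
    ‖expect (Matrix.conjTranspose (bilin p) * bilin q) ψ - star (expect (bilin p) ψ) * expect (bilin q) ψ‖ ≤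
      F (torusDist (ofLex p.1).1.toTorusSite (ofLex q.1).1.toTorusSite)

/-- (CL) at `(U, δ)`: ONE summable radial profile `F` for all even `L ≥ L₀` and all normalised
`(N_L, 0)`-sector ground states of `hubbardTorus 2 L 1 U`. -/
def BilinearClusteringAt (U δ : ℝ) : Prop :=
  ∃ F : ℕ → ℝ, IsSummableProfile F ∧ ∃ L₀ : ℕ, ∀ L ≥ L₀, Even L → ∀ Hm, Hm = hubbardTorus 2 L 1 U → ∀ ψ,
    IsGroundStateInSector Hm (2 * ⌊(1 - δ) * (L : ℝ) ^ 2 / 2⌋₊) 0 ψ → star ψ ⬝ᵥ ψ = 1 → ClustersWith F ψ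

/-- A GAPPED CLUSTERING POINT of the pure model: a parameter point `(U, δ)` carrying, uniformly in even `L ≥ L₀`,
the three energies-only clauses (PG), (H3), (H4) of the crux verbatim and the bilinear clustering (CL) of every
normalised sector ground state. Channel-agnostic: no pair form factor occurs. -/
def GappedClusteringPoint (U δ : ℝ) : Prop :=
  ParityGapAt U δ ∧ LevelCountAt U δ ∧ StaircaseCurvatureAt U δ ∧ BilinearClusteringAt U δ

/-! ### Stub signatures (`Sig.stub_*`, so that the hypothesis heads of `GappedWindow_of` carry the registered
stub names) -/

/-- STUB S — A GAPPED, SPECTRALLY RIGID, CLUSTERING WINDOW OF THE PURE MODEL EXISTS (channel-agnostic residue;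
open, size XL). Some `U > 0`, `δ ∈ (0, 1/2)` carry, uniformly in even `L ≥ L₀`: (PG) parity gap, (H3) level count,
(H4) staircase curvature — energies only — and (CL) exponential clustering of nearest-neighbour particle–hole
bilinear connected correlations in every normalised sector ground state, with ONE summable radial profile `F`
(reshape r1: not necessarily exponential — a neutral superfluid has a gapless Anderson–Bogoliubov phonon, so its
density–density connected correlations decay only as a power law `~ dist^{-3}` in `d = 2`, which IS a summable
profile; the exponential format of the birth skeleton would have made S false at every superconducting point).
Why it might fail = the crux's: at `t' = 0` the believed `d_{x²-y²}` state is nodal (PG fails), the chiral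
`d + id′` Kohn–Luttinger sliver may not exist for the pure model, at larger `U` stripes violate (CL). Sources:
RaghuKivelsonScalapino2010, ArovasBergKivelsonRaghu2022, MatveevLarkin1997, QinEtAl2020; clustering format
HastingsKoma2006 / NachtergaeleSims2006; phonon power laws PitaevskiiStringari2016 §7. -/
def Sig.stub_gappedClusteringWindow : Prop :=
  ∃ U : ℝ, 0 < U ∧ ∃ δ ∈ Set.Ioo (0 : ℝ) (1 / 2), GappedClusteringPoint U δ

/-- STUB Y — `d`-WAVE CHANNEL PINNING (identity of the channel; universal over the phase diagram, size L–XL).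
For every `U > 0`, `δ ∈ (0, 1/2)`: a gapped clustering point — parity gap (PG), sector level count (H3), staircase
curvature (H4), bilinear clustering (CL), all uniform in even `L` — has `d`-wave dominance (DOM) — the extended nearest-neighbour `B₁g` pair mode captures a fixed
fraction of the top of the pair spectrum of every sector ground state. Why it might fail: a fully gapped
extended-`s` singlet window, or a `B₁g` condensate with vanishing nearest-neighbour weight, in `0 < δ < 1/2` of the
pure model. Sources: RaghuKivelsonScalapino2010 (t'=0 Kohn–Luttinger channel map), Scalapino1995 §2, YangODLRO1962 §4. -/
def Sig.stub_dWaveChannelPinning : Prop :=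
  ∀ U δ : ℝ, 0 < U → δ ∈ Set.Ioo (0 : ℝ) (1 / 2) → GappedClusteringPoint U δ → DWaveDominanceAt U δ

/-- STUB K — VARIANCE FROM CLUSTERING (kinematic, Hamiltonian-free; true, size M; reshape r1). For every
summable radial profile `F` (`F ≥ 0`, `S_F := Σ_r (2r+1) F(r) < ∞`) there is `C'` (depending on `F` only, e.g.
`C' = 36² · 4 · S_F`) such that for every side `L` and every Fock vector `ψ` on the torus of side `L`, clustering
of the nearest-neighbour bilinear connected correlations with profile `F` gives the (H2) variance inequality with
constant `C'`: `Var_ψ(Σ a(p) B_p) = Re Σ_{p,q} conj(a p) a q ⟨B_p; B_q⟩_ψ ≤ Σ_{p,q supported} F(dist(p₁,q₁))`;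
at most `36` supported ordered orbital pairs per base site (`≤ 9` sites within `ℓ^∞` torus distance `1`,
`2 × 2` spins), and `Σ_y F(dist(x,y)) ≤ Σ_{r<L} 4(2r+1) F(r) ≤ 4 S_F` on `(ℤ/Lℤ)²` uniformly in `L`; at
`L = 0` both sides vanish. Leans on (tree): `Literature.MathematicalPhysics.QuantumLattice.sum_radial_le`,
`card_filter_torusDist_eq_le`, `card_filter_torusDist_le`, `torusDist_comm'`, `torusDist_lt`, `expect_sum`,
`expect_smul`, `FermionTorus.equivTorusSite`; Mathlib `Matrix.conjTranspose_sum`, `Matrix.conjTranspose_smul`,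
`Finset.sum_mul_sum`, `norm_sum_le`, `sum_le_tsum`. Sources: folklore (HastingsKoma2006 §2 for the format of
clustering bounds). -/
def Sig.stub_varianceOfClustering : Prop :=
  ∀ F : ℕ → ℝ, IsSummableProfile F → ∃ C' : ℝ, ∀ (L : ℕ) (ψ : Fock (Orb (FermionTorus 2 L))),
    ClustersWith F ψ → VarianceBound C' ψ

/-! ### Registered stubs

The three stub THEOREMS are stated in TREE VOCABULARY (every constant is a `Literature.MathematicalPhysics.QuantumLattice`
or Mathlib declaration, short names via the `open` above), so that the registered signature elaborates standalone with this
file's imports/opens and a landed `Theorems/ParityGapRigidityGappedWindowStub<Name>.lean` can state it verbatim; each is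
definitionally (delta) equal to the readable `Sig.stub_*` abbreviation above, which is what `GappedWindow_of` consumes. -/

/-- Registered stub S (existence of the gapped clustering window — the residue; load-bearing, hardest): `Sig.stub_gappedClusteringWindow`
unfolded — `∃ U > 0, δ ∈ (0,1/2)` with (PG) ∧ (H3) ∧ (H4) ∧ (CL, summable radial profile `F`), all uniform in even `L ≥ L₀`. -/
theorem stub_gappedClusteringWindow :
    ∃ U : ℝ, 0 < U ∧ ∃ δ ∈ Set.Ioo (0 : ℝ) (1 / 2),
      (∃ Δ : ℝ, 0 < Δ ∧ ∃ L₀ : ℕ, ∀ L ≥ L₀, Even L → ∀ Hm, Hm = hubbardTorus 2 L 1 U →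
        2 * Δ ≤ groundEnergy Hm (2 * ⌊(1 - δ) * (L : ℝ) ^ 2 / 2⌋₊ + 1) +
          groundEnergy Hm (2 * ⌊(1 - δ) * (L : ℝ) ^ 2 / 2⌋₊ - 1) -
            2 * Matrix.minEnergyOn Hm (szSector (2 * ⌊(1 - δ) * (L : ℝ) ^ 2 / 2⌋₊) 0)) ∧
      (∃ c : ℝ, 0 < c ∧ ∃ D L₀ : ℕ, ∀ L ≥ L₀, Even L → ∀ Hm, Hm = hubbardTorus 2 L 1 U →
        ∀ V : Submodule ℂ (Fock (Orb (FermionTorus 2 L))), V ≤ szSector (2 * ⌊(1 - δ) * (L : ℝ) ^ 2 / 2⌋₊) 0 →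
          (∀ φ ∈ V, (star φ ⬝ᵥ Matrix.mulVec Hm φ).re ≤
            (Matrix.minEnergyOn Hm (szSector (2 * ⌊(1 - δ) * (L : ℝ) ^ 2 / 2⌋₊) 0) + c / (L : ℝ)) *
              (star φ ⬝ᵥ φ).re) → Module.finrank ℂ V ≤ D) ∧
      (∃ C : ℝ, ∃ L₀ : ℕ, ∀ L ≥ L₀, Even L → ∀ Hm, Hm = hubbardTorus 2 L 1 U → ∀ (E : ℕ → ℝ) (n : ℕ),
        E = groundEnergy Hm → n = 2 * ⌊(1 - δ) * (L : ℝ) ^ 2 / 2⌋₊ →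
          E (n + 2) - (E n + E (n + 4)) / 2 ≤ C / (L : ℝ) ^ 2 ∧ E (n - 2) - (E n + E (n - 4)) / 2 ≤ C / (L : ℝ) ^ 2) ∧
      (∃ F : ℕ → ℝ, ((∀ r, 0 ≤ F r) ∧ Summable fun r : ℕ => (2 * (r : ℝ) + 1) * F r) ∧
        ∃ L₀ : ℕ, ∀ L ≥ L₀, Even L → ∀ Hm, Hm = hubbardTorus 2 L 1 U → ∀ ψ,
          IsGroundStateInSector Hm (2 * ⌊(1 - δ) * (L : ℝ) ^ 2 / 2⌋₊) 0 ψ → star ψ ⬝ᵥ ψ = 1 →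
            ∀ p q : Orb (FermionTorus 2 L) × Orb (FermionTorus 2 L),
              torusDist (ofLex p.1).1.toTorusSite (ofLex p.2).1.toTorusSite ≤ 1 →
              torusDist (ofLex q.1).1.toTorusSite (ofLex q.2).1.toTorusSite ≤ 1 →
                ‖expect (Matrix.conjTranspose (creation p.1 * annihilation p.2) * (creation q.1 * annihilation q.2)) ψ -
                    star (expect (creation p.1 * annihilation p.2) ψ) * expect (creation q.1 * annihilation q.2) ψ‖ ≤
                  F (torusDist (ofLex p.1).1.toTorusSite (ofLex q.1).1.toTorusSite)) := by
  sorry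

/-- Registered stub Y (`d`-wave channel pinning — where the `B₁g` channel enters): `Sig.stub_dWaveChannelPinning` unfolded —
for every `U > 0`, `δ ∈ (0,1/2)`, (PG) ∧ (H3) ∧ (H4) ∧ (CL) ⇒ (DOM). -/
theorem stub_dWaveChannelPinning :
    ∀ U δ : ℝ, 0 < U → δ ∈ Set.Ioo (0 : ℝ) (1 / 2) →
      (∃ Δ : ℝ, 0 < Δ ∧ ∃ L₀ : ℕ, ∀ L ≥ L₀, Even L → ∀ Hm, Hm = hubbardTorus 2 L 1 U →
        2 * Δ ≤ groundEnergy Hm (2 * ⌊(1 - δ) * (L : ℝ) ^ 2 / 2⌋₊ + 1) +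
          groundEnergy Hm (2 * ⌊(1 - δ) * (L : ℝ) ^ 2 / 2⌋₊ - 1) -
            2 * Matrix.minEnergyOn Hm (szSector (2 * ⌊(1 - δ) * (L : ℝ) ^ 2 / 2⌋₊) 0)) ∧
      (∃ c : ℝ, 0 < c ∧ ∃ D L₀ : ℕ, ∀ L ≥ L₀, Even L → ∀ Hm, Hm = hubbardTorus 2 L 1 U →
        ∀ V : Submodule ℂ (Fock (Orb (FermionTorus 2 L))), V ≤ szSector (2 * ⌊(1 - δ) * (L : ℝ) ^ 2 / 2⌋₊) 0 →
          (∀ φ ∈ V, (star φ ⬝ᵥ Matrix.mulVec Hm φ).re ≤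
            (Matrix.minEnergyOn Hm (szSector (2 * ⌊(1 - δ) * (L : ℝ) ^ 2 / 2⌋₊) 0) + c / (L : ℝ)) *
              (star φ ⬝ᵥ φ).re) → Module.finrank ℂ V ≤ D) ∧
      (∃ C : ℝ, ∃ L₀ : ℕ, ∀ L ≥ L₀, Even L → ∀ Hm, Hm = hubbardTorus 2 L 1 U → ∀ (E : ℕ → ℝ) (n : ℕ),
        E = groundEnergy Hm → n = 2 * ⌊(1 - δ) * (L : ℝ) ^ 2 / 2⌋₊ →
          E (n + 2) - (E n + E (n + 4)) / 2 ≤ C / (L : ℝ) ^ 2 ∧ E (n - 2) - (E n + E (n - 4)) / 2 ≤ C / (L : ℝ) ^ 2) ∧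
      (∃ F : ℕ → ℝ, ((∀ r, 0 ≤ F r) ∧ Summable fun r : ℕ => (2 * (r : ℝ) + 1) * F r) ∧
        ∃ L₀ : ℕ, ∀ L ≥ L₀, Even L → ∀ Hm, Hm = hubbardTorus 2 L 1 U → ∀ ψ,
          IsGroundStateInSector Hm (2 * ⌊(1 - δ) * (L : ℝ) ^ 2 / 2⌋₊) 0 ψ → star ψ ⬝ᵥ ψ = 1 →
            ∀ p q : Orb (FermionTorus 2 L) × Orb (FermionTorus 2 L),
              torusDist (ofLex p.1).1.toTorusSite (ofLex p.2).1.toTorusSite ≤ 1 →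
              torusDist (ofLex q.1).1.toTorusSite (ofLex q.2).1.toTorusSite ≤ 1 →
                ‖expect (Matrix.conjTranspose (creation p.1 * annihilation p.2) * (creation q.1 * annihilation q.2)) ψ -
                    star (expect (creation p.1 * annihilation p.2) ψ) * expect (creation q.1 * annihilation q.2) ψ‖ ≤
                  F (torusDist (ofLex p.1).1.toTorusSite (ofLex q.1).1.toTorusSite)) →
      (∃ κ : ℝ, 0 < κ ∧ ∃ L₀ : ℕ, ∀ (L : ℕ) [NeZero L], L₀ ≤ L → Even L → ∀ Hm, Hm = hubbardTorus 2 L 1 U → ∀ ψ,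
        IsGroundStateInSector Hm (2 * ⌊(1 - δ) * (L : ℝ) ^ 2 / 2⌋₊) 0 ψ → star ψ ⬝ᵥ ψ = 1 →
          ∀ v : Orb (FermionTorus 2 L) × Orb (FermionTorus 2 L) → ℂ, star v ⬝ᵥ v = 1 →
            κ * (L : ℝ) ^ 2 * (star v ⬝ᵥ Matrix.mulVec (twoParticleRDM ψ) v).re ≤
              (expect (Matrix.conjTranspose (pairField dWaveFormFactor L) * pairField dWaveFormFactor L) ψ).re) := by
  sorry

/-- Registered stub K (variance from clustering — kinematic, Hamiltonian-free) — **CLOSED** by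
`Summit.HubbardSuperconductivity.GappedWindow.Birth.stub_varianceOfClustering`
(`Theorems/ParityGapRigidityGappedWindowStubVarianceOfClustering.lean`, p147553, wave 1 of lead c1, 2026-08-17;
constant `C' = 2·18²·8·S_F`, `S_F = Σ' r (2r+1) F r`): `Sig.stub_varianceOfClustering` unfolded — for every summable
radial profile `F` one constant `C'` such that on every torus side `L` and for every Fock vector `ψ`, clustering of the
nearest-neighbour bilinear connected correlations with profile `F` gives the (H2) variance inequality with constant `C'`. -/
theorem stub_varianceOfClustering :
    ∀ F : ℕ → ℝ, ((∀ r, 0 ≤ F r) ∧ Summable fun r : ℕ => (2 * (r : ℝ) + 1) * F r) →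
      ∃ C' : ℝ, ∀ (L : ℕ) (ψ : Fock (Orb (FermionTorus 2 L))),
        (∀ p q : Orb (FermionTorus 2 L) × Orb (FermionTorus 2 L),
              torusDist (ofLex p.1).1.toTorusSite (ofLex p.2).1.toTorusSite ≤ 1 →
              torusDist (ofLex q.1).1.toTorusSite (ofLex q.2).1.toTorusSite ≤ 1 →
                ‖expect (Matrix.conjTranspose (creation p.1 * annihilation p.2) * (creation q.1 * annihilation q.2)) ψ -
                    star (expect (creation p.1 * annihilation p.2) ψ) * expect (creation q.1 * annihilation q.2) ψ‖ ≤
                  F (torusDist (ofLex p.1).1.toTorusSite (ofLex q.1).1.toTorusSite)) →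
        ∀ a : Orb (FermionTorus 2 L) × Orb (FermionTorus 2 L) → ℂ, (∀ p, ‖a p‖ ≤ 1) →
          (∀ p, a p ≠ 0 → torusDist (ofLex p.1).1.toTorusSite (ofLex p.2).1.toTorusSite ≤ 1) →
            (expect (Matrix.conjTranspose (∑ p, a p • (creation p.1 * annihilation p.2)) *
                (∑ p, a p • (creation p.1 * annihilation p.2))) ψ).re -
              ‖expect (∑ p, a p • (creation p.1 * annihilation p.2)) ψ‖ ^ 2 ≤ C' * (L : ℝ) ^ 2 :=
  -- CLOSED (wave 1, p147553): the landed Theorems file proves the registered signature verbatim.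
  Summit.HubbardSuperconductivity.GappedWindow.Birth.stub_varianceOfClustering

/-! ### Helper for Y: (DOM) as ONE inequality on the top of the pair spectrum (lead c1, 2026-08-17)

Wave 1 audited Y as an open physics claim whose one missing ingredient is a `B₁g` channel-selection theorem stated most
naturally on `λ_max(ρ₂)`; the three lemmas below (sorry-free) record the rewrites that turn such a theorem into the
registered (DOM) format: `⟨Δ_d†Δ_d⟩_ψ = φ_d†ρ₂(ψ)φ_d` unconditionally, and for `κ ≥ 0` on a torus of positive side
`(∀ unit v, κL²·Re v†ρ₂v ≤ Re⟨Δ_d†Δ_d⟩) ↔ κL²·(ρ₂).supRayleigh ≤ Re⟨Δ_d†Δ_d⟩`. (Not landable under `Theorems/` on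
their own: a `--supports` file of a crux with registered stubs must prove a stub by name — p149083 bounced
`supports.stub-mismatch` — so they live in the skeleton.) -/

/-- `⟨ψ, Δ_d† Δ_d ψ⟩ = φ_d† ρ₂(ψ) φ_d` on every torus of positive side, unconditionally: Yang's identity
`⟨P_v† P_v⟩ = v† ρ₂ v` (`expect_pairAnnihilator_conjTranspose_mul_holds`) and `Δ_d = P_{φ_d}`
(`pairField_eq_pairAnnihilator_dWave`). Yang (1962) §4, eq. (22); Scalapino (1995) §2. [bookkeeping] -/
theorem expect_pairField_dWave_eq (L : ℕ) [NeZero L] (ψ : Fock (Orb (FermionTorus 2 L))) :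
    expect (Matrix.conjTranspose (pairField dWaveFormFactor L) * pairField dWaveFormFactor L) ψ =
      star (pairFieldWavefunction dWaveFormFactor L) ⬝ᵥ
        Matrix.mulVec (twoParticleRDM ψ) (pairFieldWavefunction dWaveFormFactor L) :=
  expect_pairField_eq_dotProduct_twoParticleRDM dWaveFormFactor L
    expect_pairAnnihilator_conjTranspose_mul_holds (pairField_eq_pairAnnihilator_dWave L) ψ

/-- The unit sphere `{v | v† v = 1}` of pair wavefunctions on a torus of positive side is nonempty
(a basis vector). [bookkeeping] -/
theorem nonempty_unitPairWavefunction (L : ℕ) [NeZero L] :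
    Nonempty {v : Orb (FermionTorus 2 L) × Orb (FermionTorus 2 L) → ℂ // star v ⬝ᵥ v = 1} := by
  classical
  let o : Orb (FermionTorus 2 L) := orb (toLex fun _ => (0 : Fin L)) 0
  refine ⟨⟨Pi.single (o, o) 1, ?_⟩⟩
  rw [dotProduct, Finset.sum_eq_single (o, o)]
  · simp
  · intro b _ hb
    simp [hb]
  · intro h
    exact absurd (Finset.mem_univ _) h

/-- **(DOM) for all unit `v` ⇔ (DOM) at the top of the pair spectrum.** For `κ ≥ 0`, on a torus of positive side
and for any Fock vector `ψ`:
`(∀ v, v†v = 1 → κ·L²·Re v†ρ₂(ψ)v ≤ Re⟨Δ_d†Δ_d⟩_ψ) ↔ κ·L²·(ρ₂(ψ)).supRayleigh ≤ Re⟨Δ_d†Δ_d⟩_ψ`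
(`→`: `ciSup_le` over the nonempty unit sphere after dividing by `κL²` when positive, the case `κL² = 0` read off
at any unit vector; `←`: `rayleigh_le_supRayleigh_holds`). Yang (1962) §4. [bookkeeping] -/
theorem forall_dominance_iff_supRayleigh (L : ℕ) [NeZero L] {κ : ℝ} (hκ : 0 ≤ κ)
    (ψ : Fock (Orb (FermionTorus 2 L))) :
    (∀ v : Orb (FermionTorus 2 L) × Orb (FermionTorus 2 L) → ℂ, star v ⬝ᵥ v = 1 →
        κ * (L : ℝ) ^ 2 * (star v ⬝ᵥ Matrix.mulVec (twoParticleRDM ψ) v).re ≤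
          (expect (Matrix.conjTranspose (pairField dWaveFormFactor L) * pairField dWaveFormFactor L) ψ).re) ↔
      κ * (L : ℝ) ^ 2 * (twoParticleRDM ψ).supRayleigh ≤
        (expect (Matrix.conjTranspose (pairField dWaveFormFactor L) * pairField dWaveFormFactor L) ψ).re := by
  haveI := nonempty_unitPairWavefunction L
  set R : ℝ := (expect (Matrix.conjTranspose (pairField dWaveFormFactor L) *
    pairField dWaveFormFactor L) ψ).re
  have hc : 0 ≤ κ * (L : ℝ) ^ 2 := mul_nonneg hκ (by positivity)
  constructor
  · intro h
    rcases hc.lt_or_eq with hpos | hzero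
    · have hsup : (twoParticleRDM ψ).supRayleigh ≤ R / (κ * (L : ℝ) ^ 2) := by
        refine ciSup_le fun v => ?_
        rw [le_div_iff₀' hpos]
        exact h v.1 v.2
      calc κ * (L : ℝ) ^ 2 * (twoParticleRDM ψ).supRayleigh
          ≤ κ * (L : ℝ) ^ 2 * (R / (κ * (L : ℝ) ^ 2)) := mul_le_mul_of_nonneg_left hsup hc
        _ = R := mul_div_cancel₀ R hpos.ne'
    · obtain ⟨v⟩ := ‹Nonempty {v : Orb (FermionTorus 2 L) × Orb (FermionTorus 2 L) → ℂ // star v ⬝ᵥ v = 1}›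
      have h0 := h v.1 v.2
      rw [← hzero, zero_mul] at h0 ⊢
      exact h0
  · intro h v hv
    have hle : (star v ⬝ᵥ Matrix.mulVec (twoParticleRDM ψ) v).re ≤ (twoParticleRDM ψ).supRayleigh :=
      Matrix.rayleigh_le_supRayleigh_holds (twoParticleRDM ψ) v hv
    exact (mul_le_mul_of_nonneg_left hle hc).trans h

/-! ### Composition -/

/-- The kinematic step K as a closed lemma of this file (no hypothesis): the landed stub
`Summit.HubbardSuperconductivity.GappedWindow.Birth.stub_varianceOfClustering` (p147553) in the readable `Sig.*` form
consumed by the composition. [bookkeeping] -/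
theorem sig_stub_varianceOfClustering : Sig.stub_varianceOfClustering :=
  stub_varianceOfClustering

/-- **The line closes the crux BY NAME modulo the two remaining registered stubs** (r2: K is closed and used as a
lemma, no longer a hypothesis). S supplies the window `(U, δ)` with (PG), (H3), (H4) and the clustering profile
`(F, L₀)` of (CL); Y gives (DOM) at that gapped clustering point; the landed K turns `F` into ONE variance constant
`C'`, valid at every even `L ≥ L₀` because it depends on `F` only — that is (H2). [bookkeeping] -/
theorem GappedWindow_of :
    Sig.stub_gappedClusteringWindow → Sig.stub_dWaveChannelPinning → GappedWindow := by
  rintro ⟨U, hU, δ, hδ, hS⟩ hY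
  have hDOM : DWaveDominanceAt U δ := hY U δ hU hδ hS
  obtain ⟨hPG, hH3, hH4, F, hF, L₀, hcl⟩ := hS
  obtain ⟨C', hK'⟩ := sig_stub_varianceOfClustering F hF
  have hH2 : NormalFluctuationsAt U δ :=
    ⟨C', L₀, fun L hL hev Hm hHm ψ hgs hn => hK' L ψ (hcl L hL hev Hm hHm ψ hgs hn)⟩
  exact ⟨U, hU, δ, hδ, hPG, hH2, hH3, hH4, hDOM⟩

/-- The skeleton in its final shape (D-0027 §3.3): the crux BY NAME from the two remaining registered stubs (K is
landed); it becomes the crux proof when the last `stub_*` is discharged (until then it depends on `sorryAx` through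
S and Y only — no `sorry` of its own). -/
theorem GappedWindow_proof : GappedWindow :=
  GappedWindow_of stub_gappedClusteringWindow stub_dWaveChannelPinning


/-! ### Appendix Y′ (lead c2, 2026-08-17): (DOM) is NOT kinematic, even given (CL) and the sector

A sorry-free witness for Audit r3 (4): on every even torus and for every even `2 ≤ N ≤ L²` there is a normalised
vector of `szSector N 0` — the occupation basis vector with the sites of an `N/2`-subset of the even checkerboard
sublattice doubly occupied — whose nearest-neighbour bilinear connected correlations vanish beyond distance `0`
(so it clusters with the summable profile `2·1_{r=0}`), whose `d`-wave pair amplitude `⟨Δ_d†Δ_d⟩` is EXACTLY `0`,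
and whose two-particle density matrix has a unit Rayleigh quotient equal to `1`; hence the (DOM) inequality
`κ·L²·Re v†ρ₂v ≤ Re⟨Δ_d†Δ_d⟩` fails on it for every `κ > 0`. Any proof of Y must therefore use the ground-state
property at a point where (PG), (H3), (H4) hold. -/

namespace NonKinematic

open Matrix Literature.Probability.LatticeModels
open Finset hiding expect

variable {L : ℕ}

/-- The checkerboard parity `x₀ + x₁ mod 2` of a torus site, as an additive homomorphism
`(ℤ/Lℤ)² →+ ℤ/2ℤ` (well defined for even `L`). [bookkeeping] -/
def parity (hL : 2 ∣ L) : TorusSite 2 L →+ ZMod 2 where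
  toFun x := ZMod.castHom hL (ZMod 2) (x 0) + ZMod.castHom hL (ZMod 2) (x 1)
  map_zero' := by simp
  map_add' x y := by
    simp only [Pi.add_apply, map_add]
    ring

theorem parity_apply (hL : 2 ∣ L) (x : TorusSite 2 L) :
    parity hL x = ZMod.castHom hL (ZMod 2) (x 0) + ZMod.castHom hL (ZMod 2) (x 1) := rfl

/-- Parity of a projected step of `ℤ²`. [bookkeeping] -/
theorem parity_proj (hL : 2 ∣ L) (e : Site 2) :
    parity hL (Torus.proj L e) = ((e 0 : ℤ) : ZMod 2) + ((e 1 : ℤ) : ZMod 2) := by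
  simp only [parity_apply, Torus.proj_apply, map_intCast]

/-- Every unit step has odd parity. [bookkeeping] -/
theorem parity_proj_unitStep (hL : 2 ∣ L) {e : Site 2} (he : e ∈ unitSteps) :
    parity hL (Torus.proj L e) = 1 := by
  rw [parity_proj]
  simp only [unitSteps, mem_insert, mem_singleton] at he
  rcases he with rfl | rfl | rfl | rfl <;> simp

/-- A unit step changes the parity. [bookkeeping] -/
theorem parity_add_proj_unitStep (hL : 2 ∣ L) (x : TorusSite 2 L) {e : Site 2} (he : e ∈ unitSteps) :
    parity hL (x + Torus.proj L e) = parity hL x + 1 := by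
  rw [map_add, parity_proj_unitStep hL he]

/-- The even checkerboard sublattice of `(ℤ/Lℤ)²`. [bookkeeping] -/
def evenSub (hL : 2 ∣ L) [NeZero L] : Finset (TorusSite 2 L) :=
  univ.filter fun x => parity hL x = 0

theorem mem_evenSub (hL : 2 ∣ L) [NeZero L] (x : TorusSite 2 L) : x ∈ evenSub hL ↔ parity hL x = 0 := by
  simp [evenSub]

/-- In `ℤ/2ℤ` every element is `0` or `1`. [bookkeeping] -/
theorem zmod_two_eq_zero_or_one : ∀ z : ZMod 2, z = 0 ∨ z = 1 := by
  decide

/-- The even sublattice has exactly half the sites: `2·#evenSub = L²`. [bookkeeping] -/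
theorem two_mul_card_evenSub (hL : 2 ∣ L) [NeZero L] : 2 * (evenSub hL).card = L ^ 2 := by
  classical
  -- the shift by `e₁` is a bijection of the torus exchanging the two sublattices
  set t : TorusSite 2 L := Torus.proj L (Pi.single 0 1) with ht
  have hstep : (Pi.single 0 1 : Site 2) ∈ unitSteps := by simp [unitSteps]
  have hodd : (univ.filter fun x : TorusSite 2 L => parity hL x = 1) =
      (evenSub hL).map (addRightEmbedding t) := by
    ext y
    simp only [mem_filter, mem_univ, true_and, mem_map, mem_evenSub, addRightEmbedding_apply]
    constructor
    · intro hy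
      refine ⟨y - t, ?_, sub_add_cancel y t⟩
      have h := parity_add_proj_unitStep hL (y - t) hstep
      rw [← ht, sub_add_cancel, hy] at h
      -- h : 1 = parity (y - t) + 1
      rcases zmod_two_eq_zero_or_one (parity hL (y - t)) with h0 | h1
      · exact h0
      · rw [h1] at h
        exact absurd h (by decide)
    · rintro ⟨x, hx, rfl⟩
      rw [ht, parity_add_proj_unitStep hL x hstep, hx, zero_add]
  have hcard : (univ.filter fun x : TorusSite 2 L => parity hL x = 1).card = (evenSub hL).card := by
    rw [hodd, card_map]
  have hunion : evenSub hL ∪ (univ.filter fun x : TorusSite 2 L => parity hL x = 1) = univ := by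
    ext x
    simp only [mem_union, mem_evenSub, mem_filter, mem_univ, true_and, iff_true]
    exact zmod_two_eq_zero_or_one _
  have hdisj : Disjoint (evenSub hL) (univ.filter fun x : TorusSite 2 L => parity hL x = 1) := by
    rw [disjoint_left]
    intro x hx hx'
    rw [mem_evenSub] at hx
    rw [mem_filter] at hx'
    exact zero_ne_one (hx.symm.trans hx'.2)
  have := card_union_of_disjoint hdisj
  rw [hunion, card_univ, hcard, ← two_mul] at this
  rw [← this, Fintype.card_pi, Finset.prod_const, ZMod.card, Finset.card_univ, Fintype.card_fin]

/-! #### Occupation-basis calculus: signed basis vectors, two- and four-point functions -/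

section FockBasis

variable {ι : Type*} [LinearOrder ι]

/-- The occupation basis vector `|s⟩` (a named wrapper of `Pi.single s 1`, so that the decidability
instance inside is fixed once and for all in this generic context). [bookkeeping] -/
def basisVec (s : Finset ι) : Fock ι := Pi.single s 1

theorem basisVec_apply_self (s : Finset ι) : basisVec s s = (1 : ℂ) := by
  simp [basisVec]

theorem basisVec_apply_of_ne {s t : Finset ι} (h : t ≠ s) : basisVec s t = (0 : ℂ) := by
  simp [basisVec, Pi.single_eq_of_ne h]

/-- `star |s⟩ = |s⟩`. [bookkeeping] -/
theorem star_basisVec (s : Finset ι) : star (basisVec s) = basisVec s := by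
  ext t
  by_cases h : t = s
  · subst h; simp [basisVec_apply_self]
  · simp [basisVec_apply_of_ne h]

/-- The Jordan–Wigner sign has norm one. [bookkeeping] -/
theorem norm_jwSign (i : ι) (s : Finset ι) : ‖jwSign i s‖ = 1 := by
  simp [jwSign]

/-- A vector is ZERO OR A SIGNED BASIS VECTOR: `0` or `c • |t⟩` with `‖c‖ = 1`. [bookkeeping] -/
def IsSB (v : Fock ι) : Prop :=
  v = 0 ∨ ∃ (t : Finset ι) (c : ℂ), ‖c‖ = 1 ∧ v = c • basisVec t

theorem isSB_basisVec (s : Finset ι) : IsSB (basisVec s) :=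
  Or.inr ⟨s, 1, by simp, by simp⟩

theorem IsSB.norm_apply_le {v : Fock ι} (hv : IsSB v) (s : Finset ι) : ‖v s‖ ≤ 1 := by
  rcases hv with rfl | ⟨t, c, hc, rfl⟩
  · simp
  · rw [Pi.smul_apply, smul_eq_mul, norm_mul, hc, one_mul]
    by_cases h : s = t
    · subst h; simp [basisVec_apply_self]
    · simp [basisVec_apply_of_ne h]

variable [Fintype ι]

/-- `⟨s|s⟩ = 1`. [bookkeeping] -/
theorem basisVec_norm (s : Finset ι) : star (basisVec s) ⬝ᵥ basisVec s = 1 := by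
  rw [star_basisVec, basisVec, single_dotProduct, one_mul, Pi.single_eq_same]

/-- `⟨s| M |s⟩ = (M |s⟩)(s)`. [bookkeeping] -/
theorem expect_basisVec (M : Matrix (Finset ι) (Finset ι) ℂ) (s : Finset ι) :
    expect M (basisVec s) = (M *ᵥ basisVec s) s := by
  rw [expect, star_basisVec]
  unfold basisVec
  rw [single_dotProduct, one_mul]

/-- `c_i (c • |t⟩)`. [bookkeeping] -/
theorem annihilation_mulVec_smul_basisVec (i : ι) (c : ℂ) (t : Finset ι) :
    annihilation i *ᵥ (c • basisVec t) =
      if i ∈ t then (c * jwSign i t) • basisVec (t.erase i) else 0 := by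
  rw [mulVec_smul, basisVec, annihilation_mulVec_single]
  split_ifs <;> simp [smul_smul, basisVec]

/-- `c_i |t⟩`. [bookkeeping] -/
theorem annihilation_mulVec_basisVec (i : ι) (t : Finset ι) :
    annihilation i *ᵥ basisVec t = if i ∈ t then jwSign i t • basisVec (t.erase i) else 0 := by
  have h := annihilation_mulVec_smul_basisVec i 1 t
  rwa [one_smul, one_mul] at h

/-- `c†_i (c • |t⟩)`. [bookkeeping] -/
theorem creation_mulVec_smul_basisVec (i : ι) (c : ℂ) (t : Finset ι) :
    creation i *ᵥ (c • basisVec t) =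
      if i ∈ t then 0 else (c * jwSign i t) • basisVec (insert i t) := by
  rw [mulVec_smul, basisVec, FermionOperatorsProofs.creation_mulVec_single]
  split_ifs <;> simp [smul_smul, basisVec]

theorem IsSB.annihilation {v : Fock ι} (hv : IsSB v) (i : ι) : IsSB (annihilation i *ᵥ v) := by
  rcases hv with rfl | ⟨t, c, hc, rfl⟩
  · exact Or.inl (mulVec_zero _)
  · rw [annihilation_mulVec_smul_basisVec]
    by_cases hi : i ∈ t
    · rw [if_pos hi]
      exact Or.inr ⟨t.erase i, c * jwSign i t, by rw [norm_mul, hc, norm_jwSign, one_mul], rfl⟩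
    · rw [if_neg hi]
      exact Or.inl rfl

theorem IsSB.creation {v : Fock ι} (hv : IsSB v) (i : ι) : IsSB (creation i *ᵥ v) := by
  rcases hv with rfl | ⟨t, c, hc, rfl⟩
  · exact Or.inl (mulVec_zero _)
  · rw [creation_mulVec_smul_basisVec]
    by_cases hi : i ∈ t
    · rw [if_pos hi]
      exact Or.inl rfl
    · rw [if_neg hi]
      exact Or.inr ⟨insert i t, c * jwSign i t, by rw [norm_mul, hc, norm_jwSign, one_mul], rfl⟩

/-- `|⟨s| c†_i c_j |s⟩| ≤ 1`. [bookkeeping] -/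
theorem norm_expect_two_le (i j : ι) (s : Finset ι) :
    ‖expect (creation i * annihilation j) (basisVec s)‖ ≤ 1 := by
  rw [expect_basisVec, ← mulVec_mulVec]
  exact (((isSB_basisVec s).annihilation j).creation i).norm_apply_le s

/-- `|⟨s| c†_i c_j c†_k c_l |s⟩| ≤ 1`. [bookkeeping] -/
theorem norm_expect_four_le (i j k l : ι) (s : Finset ι) :
    ‖expect (creation i * annihilation j * (creation k * annihilation l)) (basisVec s)‖ ≤ 1 := by
  rw [expect_basisVec, ← mulVec_mulVec, ← mulVec_mulVec, ← mulVec_mulVec]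
  exact (((((isSB_basisVec s).annihilation l).creation k).annihilation j).creation i).norm_apply_le s

/-- `⟨s| n_i |s⟩ = [i ∈ s]`. [bookkeeping] -/
theorem expect_numberAt_basisVec (i : ι) (s : Finset ι) :
    expect (creation i * annihilation i) (basisVec s) = if i ∈ s then 1 else 0 := by
  rw [expect_basisVec, show creation i * annihilation i = numberAt i from rfl, numberAt_eq_diagonal,
    mulVec_diagonal]
  by_cases hi : i ∈ s <;> simp [hi, basisVec_apply_self]

/-- `⟨s| c†_i c_j |s⟩ = 0` for `i ≠ j`. [bookkeeping] -/
theorem expect_two_basisVec_of_ne {i j : ι} (h : i ≠ j) (s : Finset ι) :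
    expect (creation i * annihilation j) (basisVec s) = 0 := by
  rw [expect_basisVec, ← mulVec_mulVec, annihilation_mulVec_basisVec]
  by_cases hj : j ∈ s
  · rw [if_pos hj, creation_mulVec_smul_basisVec]
    by_cases hi : i ∈ s.erase j
    · rw [if_pos hi, Pi.zero_apply]
    · have hne : s ≠ insert i (s.erase j) := by
        intro hs
        have : j ∈ insert i (s.erase j) := hs ▸ hj
        rw [mem_insert] at this
        rcases this with hji | hje
        · exact h hji.symm
        · exact (notMem_erase j s) hje
      rw [if_neg hi, Pi.smul_apply, smul_eq_mul, basisVec_apply_of_ne hne, mul_zero]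
  · rw [if_neg hj, mulVec_zero, Pi.zero_apply]

/-- `⟨s| n_i n_k |s⟩ = [i ∈ s][k ∈ s]`. [bookkeeping] -/
theorem expect_numberAt_numberAt_basisVec (i k : ι) (s : Finset ι) :
    expect (creation i * annihilation i * (creation k * annihilation k)) (basisVec s) =
      (if i ∈ s then 1 else 0) * (if k ∈ s then 1 else 0) := by
  rw [expect_basisVec, show creation i * annihilation i = numberAt i from rfl,
    show creation k * annihilation k = numberAt k from rfl, numberAt_eq_diagonal, numberAt_eq_diagonal,
    diagonal_mul_diagonal, mulVec_diagonal]
  by_cases hi : i ∈ s <;> by_cases hk : k ∈ s <;> simp [hi, hk, basisVec_apply_self]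

/-- **Selection rule.** `⟨s| c†_i c_j c†_k c_l |s⟩ = 0` unless `(i = j ∧ k = l)` or `(i = l ∧ j = k)`
(orbital-wise particle-number conservation on a basis vector). [bookkeeping] -/
theorem expect_four_basisVec_eq_zero {i j k l : ι} (h₁ : ¬(i = j ∧ k = l)) (h₂ : ¬(i = l ∧ j = k))
    (s : Finset ι) :
    expect (creation i * annihilation j * (creation k * annihilation l)) (basisVec s) = 0 := by
  rw [expect_basisVec, ← mulVec_mulVec, ← mulVec_mulVec, ← mulVec_mulVec, annihilation_mulVec_basisVec]
  by_cases hl : l ∈ s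
  swap
  · rw [if_neg hl, mulVec_zero, mulVec_zero, mulVec_zero, Pi.zero_apply]
  rw [if_pos hl, creation_mulVec_smul_basisVec]
  by_cases hk : k ∈ s.erase l
  · rw [if_pos hk, mulVec_zero, mulVec_zero, Pi.zero_apply]
  rw [if_neg hk, annihilation_mulVec_smul_basisVec]
  by_cases hj : j ∈ insert k (s.erase l)
  swap
  · rw [if_neg hj, mulVec_zero, Pi.zero_apply]
  rw [if_pos hj, creation_mulVec_smul_basisVec]
  by_cases hi : i ∈ (insert k (s.erase l)).erase j
  · rw [if_pos hi, Pi.zero_apply]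
  rw [if_neg hi]
  -- the resulting basis vector is not `|s⟩`
  have hne : s ≠ insert i ((insert k (s.erase l)).erase j) := by
    intro hs
    by_cases hkl : k = l
    · subst hkl
      rw [insert_erase hl] at hs hj
      have hij : i ≠ j := fun hij => h₁ ⟨hij, rfl⟩
      have : j ∈ insert i (s.erase j) := hs ▸ hj
      rw [mem_insert] at this
      rcases this with hji | hje
      · exact hij hji.symm
      · exact (notMem_erase j s) hje
    · have hks : k ∉ s := fun hks => hk (mem_erase.2 ⟨hkl, hks⟩)
      by_cases hjk : j = k
      · subst hjk
        rw [erase_insert hk] at hs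
        have hil : i ≠ l := fun hil => h₂ ⟨hil, rfl⟩
        have : l ∈ insert i (s.erase l) := hs ▸ hl
        rw [mem_insert] at this
        rcases this with hli | hle
        · exact hil hli.symm
        · exact (notMem_erase l s) hle
      · apply hks
        rw [hs, mem_insert, mem_erase, mem_insert]
        exact Or.inr ⟨fun h => hjk h.symm, Or.inl rfl⟩
  rw [Pi.smul_apply, smul_eq_mul, basisVec_apply_of_ne hne, mul_zero]

/-- `⟨s| c†_a c†_b c_b c_a |s⟩ = 1` for two distinct occupied orbitals (the diagonal entry
`ρ₂((a,b),(a,b)) = ⟨n_a n_b⟩` of Yang's two-particle density matrix). [bookkeeping] -/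
theorem expect_rho2_diag_basisVec {a b : ι} (hab : a ≠ b) {s : Finset ι} (ha : a ∈ s) (hb : b ∈ s) :
    expect (creation a * creation b * annihilation b * annihilation a) (basisVec s) = 1 := by
  have hb' : b ∈ s.erase a := mem_erase.2 ⟨hab.symm, hb⟩
  rw [expect_basisVec, ← mulVec_mulVec, ← mulVec_mulVec, ← mulVec_mulVec, annihilation_mulVec_basisVec,
    if_pos ha, annihilation_mulVec_smul_basisVec, if_pos hb', creation_mulVec_smul_basisVec,
    if_neg (notMem_erase b _), insert_erase hb', creation_mulVec_smul_basisVec, if_neg (notMem_erase a s),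
    insert_erase ha, Pi.smul_apply, smul_eq_mul, basisVec_apply_self, mul_one,
    jwSign_erase_of_not_lt (lt_irrefl b), jwSign_erase_of_not_lt (lt_irrefl a)]
  calc jwSign a s * jwSign b (s.erase a) * jwSign b (s.erase a) * jwSign a s
      = (jwSign a s * jwSign a s) * (jwSign b (s.erase a) * jwSign b (s.erase a)) := by ring
    _ = 1 := by rw [jwSign_mul_self, jwSign_mul_self, mul_one]

/-- A unit pair wavefunction on two distinct occupied orbitals has Rayleigh quotient `1` in `ρ₂(|s⟩)`. [bookkeeping] -/
theorem exists_rayleigh_rho2_basisVec {a b : ι} (hab : a ≠ b) {s : Finset ι} (ha : a ∈ s) (hb : b ∈ s) :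
    ∃ v : ι × ι → ℂ, star v ⬝ᵥ v = 1 ∧ (star v ⬝ᵥ (twoParticleRDM (basisVec s)) *ᵥ v).re = 1 := by
  have hstar : star (Pi.single (a, b) (1 : ℂ) : ι × ι → ℂ) = Pi.single (a, b) 1 := by
    ext q
    by_cases h : q = (a, b)
    · subst h; simp
    · simp [Pi.single_eq_of_ne h]
  refine ⟨Pi.single (a, b) 1, ?_, ?_⟩
  · rw [hstar, single_dotProduct, one_mul, Pi.single_eq_same]
  · rw [hstar, single_dotProduct, one_mul, mulVec_single_one, col_apply,
      show twoParticleRDM (basisVec s) (a, b) (a, b) =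
        expect (creation a * creation b * annihilation b * annihilation a) (basisVec s) from rfl,
      expect_rho2_diag_basisVec hab ha hb, Complex.one_re]

/-- `c_a c_b |s⟩ = 0` unless both orbitals are occupied. [bookkeeping] -/
theorem annihilation_annihilation_basisVec_eq_zero {a b : ι} {s : Finset ι} (h : ¬(a ∈ s ∧ b ∈ s)) :
    (annihilation a * annihilation b) *ᵥ basisVec s = 0 := by
  rw [← mulVec_mulVec, annihilation_mulVec_basisVec]
  by_cases hb : b ∈ s
  · rw [if_pos hb, annihilation_mulVec_smul_basisVec, if_neg]
    exact fun ha => h ⟨(mem_erase.1 ha).2, hb⟩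
  · rw [if_neg hb, mulVec_zero]

/-- Connected particle–hole correlation of `|s⟩`: the expression bounded by (CL). [bookkeeping] -/
def connected (i j k l : ι) (s : Finset ι) : ℂ :=
  expect ((creation i * annihilation j)ᴴ * (creation k * annihilation l)) (basisVec s) -
    star (expect (creation i * annihilation j) (basisVec s)) * expect (creation k * annihilation l) (basisVec s)

/-- `|connected| ≤ 2` always. [bookkeeping] -/
theorem norm_connected_le_two (i j k l : ι) (s : Finset ι) : ‖connected i j k l s‖ ≤ 2 := by
  rw [connected, conjTranspose_mul, creation_conjTranspose, annihilation_conjTranspose]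
  refine (norm_sub_le _ _).trans ?_
  have h1 := norm_expect_four_le j i k l s
  have h2 : ‖star (expect (creation i * annihilation j) (basisVec s)) *
      expect (creation k * annihilation l) (basisVec s)‖ ≤ 1 := by
    rw [norm_mul, norm_star]
    exact mul_le_one₀ (norm_expect_two_le _ _ _) (norm_nonneg _) (norm_expect_two_le _ _ _)
  linarith

/-- The connected correlation VANISHES when the first orbitals differ (`i ≠ k`). [bookkeeping] -/
theorem connected_eq_zero {i j k l : ι} (hik : i ≠ k) (s : Finset ι) : connected i j k l s = 0 := by
  rw [connected, conjTranspose_mul, creation_conjTranspose, annihilation_conjTranspose, sub_eq_zero]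
  by_cases hdiag : i = j ∧ k = l
  · obtain ⟨hij, hkl⟩ := hdiag
    rw [← hij, ← hkl, expect_numberAt_numberAt_basisVec, expect_numberAt_basisVec, expect_numberAt_basisVec]
    by_cases hi : i ∈ s <;> by_cases hk : k ∈ s <;> simp [hi, hk]
  · rw [expect_four_basisVec_eq_zero (fun h => hdiag ⟨h.1.symm, h.2⟩) (fun h => hik h.2)]
    by_cases hij : i = j
    · have hkl : k ≠ l := fun hkl => hdiag ⟨hij, hkl⟩
      rw [expect_two_basisVec_of_ne hkl, mul_zero]
    · rw [expect_two_basisVec_of_ne hij, star_zero, zero_mul]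

end FockBasis

/-! #### The witness on the even torus -/

section Witness

variable [NeZero L]

/-- `(ℤ/Lℤ)² ↪ FermionTorus 2 L` via canonical representatives. [bookkeeping] -/
def ofTorusSiteEmb : TorusSite 2 L ↪ FermionTorus 2 L :=
  ⟨FermionTorus.ofTorusSite, fun x y h => by simpa using congrArg FermionTorus.toTorusSite h⟩

/-- The configuration with every site of `B` doubly occupied. [bookkeeping] -/
def cfg (B : Finset (TorusSite 2 L)) : Finset (Orb (FermionTorus 2 L)) :=
  pairSet (B.map ofTorusSiteEmb) (B.map ofTorusSiteEmb)

theorem orb_ofTorusSite_mem_cfg (B : Finset (TorusSite 2 L)) (x : TorusSite 2 L) (σ : Fin 2) :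
    orb (FermionTorus.ofTorusSite x) σ ∈ cfg B ↔ x ∈ B := by
  have h : FermionTorus.ofTorusSite x ∈ B.map ofTorusSiteEmb ↔ x ∈ B := Finset.mem_map' ofTorusSiteEmb
  fin_cases σ
  · exact (orb_zero_mem_pairSet _ _ _).trans h
  · exact (orb_one_mem_pairSet _ _ _).trans h

theorem card_cfg (B : Finset (TorusSite 2 L)) : (cfg B).card = 2 * B.card := by
  rw [cfg, card_pairSet, card_map, two_mul]

/-- The witness state `|cfg B⟩`. [bookkeeping] -/
abbrev wit (B : Finset (TorusSite 2 L)) : Fock (Orb (FermionTorus 2 L)) := basisVec (cfg B)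

theorem wit_mem_szSector (B : Finset (TorusSite 2 L)) : wit B ∈ szSector (2 * B.card) 0 := by
  rw [mem_szSector_iff]
  refine ⟨fun t ht => basisVec_apply_of_ne ?_, ?_⟩
  · rintro rfl
    exact ht (card_cfg B)
  · funext t
    rw [LiebThm1.spinZ_mulVec_apply, Complex.ofReal_zero, zero_smul, Pi.zero_apply]
    by_cases h : t = cfg B
    · subst h
      rw [cfg, upPart_pairSet, downPart_pairSet, sub_self, mul_zero, zero_mul]
    · rw [show wit B t = 0 from basisVec_apply_of_ne h, mul_zero]

/-- The `d`-wave pair field annihilates the witness when `B` lies in one checkerboard sublattice. [bookkeeping] -/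
theorem pairField_mulVec_wit (hL : 2 ∣ L) {B : Finset (TorusSite 2 L)} (hB : B ⊆ evenSub hL) :
    pairField dWaveFormFactor L *ᵥ wit B = 0 := by
  rw [pairField, Matrix.sum_mulVec]
  refine Finset.sum_eq_zero fun x _ => ?_
  rw [localPair, Matrix.sum_mulVec]
  refine Finset.sum_eq_zero fun e he => ?_
  rw [Finset.mem_insert] at he
  rcases he with rfl | he
  · rw [dWaveFormFactor_zero, zero_div, Complex.ofReal_zero, zero_smul, zero_mulVec]
  · have key : ∀ σ τ : Fin 2, (annihilation (orb (FermionTorus.ofTorusSite x) σ) *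
        annihilation (orb (FermionTorus.ofTorusSite (x + Torus.proj L e)) τ)) *ᵥ wit B = 0 := by
      intro σ τ
      refine annihilation_annihilation_basisVec_eq_zero fun hmem => ?_
      rw [orb_ofTorusSite_mem_cfg, orb_ofTorusSite_mem_cfg] at hmem
      have p1 := (mem_evenSub hL _).1 (hB hmem.1)
      have p2 := (mem_evenSub hL _).1 (hB hmem.2)
      rw [parity_add_proj_unitStep hL x he, p1, zero_add] at p2
      exact one_ne_zero p2
    rw [smul_mulVec, sub_mulVec, key, key, sub_zero, smul_zero]

theorem expect_pairField_wit (hL : 2 ∣ L) {B : Finset (TorusSite 2 L)} (hB : B ⊆ evenSub hL) :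
    expect ((pairField dWaveFormFactor L)ᴴ * pairField dWaveFormFactor L) (wit B) = 0 := by
  rw [expect, ← mulVec_mulVec, pairField_mulVec_wit hL hB, mulVec_zero, dotProduct_zero]

/-- A doubly occupied site gives a unit Rayleigh quotient `1` of `ρ₂`. [bookkeeping] -/
theorem rho2_wit {B : Finset (TorusSite 2 L)} {x : TorusSite 2 L} (hx : x ∈ B) :
    ∃ v : Orb (FermionTorus 2 L) × Orb (FermionTorus 2 L) → ℂ,
      star v ⬝ᵥ v = 1 ∧ (star v ⬝ᵥ (twoParticleRDM (wit B)) *ᵥ v).re = 1 := by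
  have hab : orb (FermionTorus.ofTorusSite x) 0 ≠ orb (FermionTorus.ofTorusSite x) (1 : Fin 2) := by
    simp [orb]
  exact exists_rayleigh_rho2_basisVec hab ((orb_ofTorusSite_mem_cfg B x 0).2 hx)
    ((orb_ofTorusSite_mem_cfg B x 1).2 hx)

/-- The witness clusters with the profile `2·1_{r=0}`: connected correlations of particle–hole bilinears
vanish unless the two base sites coincide. [bookkeeping] -/
theorem clusters_wit (B : Finset (TorusSite 2 L)) (p q : Orb (FermionTorus 2 L) × Orb (FermionTorus 2 L)) :
    ‖expect ((creation p.1 * annihilation p.2)ᴴ * (creation q.1 * annihilation q.2)) (wit B) -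
        star (expect (creation p.1 * annihilation p.2) (wit B)) * expect (creation q.1 * annihilation q.2) (wit B)‖ ≤
      (if torusDist (ofLex p.1).1.toTorusSite (ofLex q.1).1.toTorusSite = 0 then 2 else 0 : ℝ) := by
  change ‖connected p.1 p.2 q.1 q.2 (cfg B)‖ ≤ _
  by_cases hsite : (ofLex p.1).1 = (ofLex q.1).1
  · have h0 : torusDist (ofLex p.1).1.toTorusSite (ofLex q.1).1.toTorusSite = 0 := by
      rw [hsite, torusDist_self]
    rw [if_pos h0]
    exact norm_connected_le_two _ _ _ _ _
  · have hpq : p.1 ≠ q.1 := fun h => hsite (by rw [h])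
    rw [connected_eq_zero hpq, norm_zero]
    split_ifs <;> norm_num

end Witness

/-! #### Assembly: the witness, and the failure of (DOM) on it -/

section Assembly

variable [NeZero L]

/-- The profile `2·1_{r=0}` is a summable radial profile. [bookkeeping] -/
theorem isSummableProfile_indicator : IsSummableProfile (fun r : ℕ => if r = 0 then (2 : ℝ) else 0) := by
  refine ⟨fun r => by dsimp only; split_ifs <;> norm_num, ?_⟩
  apply summable_of_ne_finset_zero (s := {0})
  intro r hr
  rw [Finset.mem_singleton] at hr
  simp [hr]

/-- **The witness.** On an even torus, for every even `2 ≤ N ≤ L²`: a normalised vector of `szSector N 0` which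
clusters with the summable profile `2·1_{r=0}`, has `⟨Δ_d†Δ_d⟩ = 0`, and has a unit pair wavefunction with
Rayleigh quotient `1` in its two-particle density matrix. [bookkeeping] -/
theorem witness (hL : Even L) (N : ℕ) (hN : Even N) (h2N : 2 ≤ N) (hNL : N ≤ L ^ 2) :
    ∃ ψ : Fock (Orb (FermionTorus 2 L)),
      ψ ∈ szSector N 0 ∧ star ψ ⬝ᵥ ψ = 1 ∧
      ClustersWith (fun r => if r = 0 then 2 else 0) ψ ∧
      expect ((pairField dWaveFormFactor L)ᴴ * pairField dWaveFormFactor L) ψ = 0 ∧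
      ∃ v : Orb (FermionTorus 2 L) × Orb (FermionTorus 2 L) → ℂ, star v ⬝ᵥ v = 1 ∧
        (star v ⬝ᵥ (twoParticleRDM ψ) *ᵥ v).re = 1 := by
  have hL2 : 2 ∣ L := hL.two_dvd
  obtain ⟨n, rfl⟩ := hN
  have hcard : n ≤ (evenSub hL2).card := by
    have := two_mul_card_evenSub hL2
    omega
  obtain ⟨B, hB, hBcard⟩ := Finset.exists_subset_card_eq hcard
  have hBne : B.Nonempty := by
    rw [← Finset.card_pos, hBcard]
    omega
  obtain ⟨x, hx⟩ := hBne
  refine ⟨wit B, ?_, basisVec_norm _, fun p q _ _ => clusters_wit B p q, expect_pairField_wit hL2 hB,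
    rho2_wit hx⟩
  rw [show n + n = 2 * B.card by rw [hBcard]; ring]
  exact wit_mem_szSector B

/-- **(DOM) is not kinematic, even given (CL) and the sector** (Audit r3 (4), lead c2). For every `κ > 0`,
every even torus side `L ≥ 1` and every even `2 ≤ N ≤ L²` there is a normalised vector of `szSector N 0`
clustering with the summable profile `2·1_{r=0}` on which the (DOM) inequality
`∀ unit v, κ·L²·Re v†ρ₂(ψ)v ≤ Re⟨Δ_d†Δ_d⟩_ψ` FAILS (its right-hand side is `0`, its left-hand side reaches
`κ L²`). Hence stub Y cannot be discharged from (CL)/(H2)-type hypotheses and sector membership alone: the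
ground-state property at a point where (PG), (H3), (H4) hold is essential. [bookkeeping] -/
theorem dominance_not_kinematic (hL : Even L) (N : ℕ) (hN : Even N) (h2N : 2 ≤ N) (hNL : N ≤ L ^ 2)
    (κ : ℝ) (hκ : 0 < κ) :
    ∃ ψ : Fock (Orb (FermionTorus 2 L)), ψ ∈ szSector N 0 ∧ star ψ ⬝ᵥ ψ = 1 ∧
      ClustersWith (fun r => if r = 0 then 2 else 0) ψ ∧
      ¬ ∀ v : Orb (FermionTorus 2 L) × Orb (FermionTorus 2 L) → ℂ, star v ⬝ᵥ v = 1 →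
          κ * (L : ℝ) ^ 2 * (star v ⬝ᵥ Matrix.mulVec (twoParticleRDM ψ) v).re ≤
            (expect (Matrix.conjTranspose (pairField dWaveFormFactor L) * pairField dWaveFormFactor L) ψ).re := by
  obtain ⟨ψ, hψ, hn, hcl, hpf, v, hv, hρ⟩ := witness hL N hN h2N hNL
  refine ⟨ψ, hψ, hn, hcl, fun h => ?_⟩
  have h1 := h v hv
  rw [hρ, hpf, mul_one, Complex.zero_re] at h1
  have hLpos : (0 : ℝ) < (L : ℝ) := by exact_mod_cast Nat.pos_of_ne_zero (NeZero.ne L)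
  nlinarith [mul_pos hκ (pow_pos hLpos 2)]

/-- The same at the crux's filling `N_L = 2⌊(1-δ)L²/2⌋`, `0 < δ < 1/2`, for every even `L ≥ 2`: the
hypothesis-shape "(CL) ∧ normalised ∧ in the `(N_L, 0)` sector ⇒ (DOM)" is FALSE for every `κ > 0`.
[bookkeeping] -/
theorem dominance_not_kinematic_at {δ : ℝ} (hδ : δ ∈ Set.Ioo (0 : ℝ) (1 / 2)) (hL : Even L) (h2 : 2 ≤ L)
    (κ : ℝ) (hκ : 0 < κ) :
    ∃ ψ : Fock (Orb (FermionTorus 2 L)), ψ ∈ szSector (2 * ⌊(1 - δ) * (L : ℝ) ^ 2 / 2⌋₊) 0 ∧ star ψ ⬝ᵥ ψ = 1 ∧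
      ClustersWith (fun r => if r = 0 then 2 else 0) ψ ∧
      ¬ ∀ v : Orb (FermionTorus 2 L) × Orb (FermionTorus 2 L) → ℂ, star v ⬝ᵥ v = 1 →
          κ * (L : ℝ) ^ 2 * (star v ⬝ᵥ Matrix.mulVec (twoParticleRDM ψ) v).re ≤
            (expect (Matrix.conjTranspose (pairField dWaveFormFactor L) * pairField dWaveFormFactor L) ψ).re := by
  have hL' : (2 : ℝ) ≤ L := by exact_mod_cast h2
  have hy0 : (0 : ℝ) ≤ (1 - δ) * (L : ℝ) ^ 2 / 2 :=
    div_nonneg (mul_nonneg (by linarith [hδ.2]) (by positivity)) (by norm_num)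
  refine dominance_not_kinematic hL _ (even_two_mul _) ?_ ?_ κ hκ
  · have : 1 ≤ ⌊(1 - δ) * (L : ℝ) ^ 2 / 2⌋₊ := by
      rw [Nat.one_le_floor_iff]
      nlinarith [hδ.2]
    omega
  · have hfl := Nat.floor_le hy0
    have : ((2 * ⌊(1 - δ) * (L : ℝ) ^ 2 / 2⌋₊ : ℕ) : ℝ) ≤ ((L ^ 2 : ℕ) : ℝ) := by
      push_cast
      nlinarith [hδ.1]
    exact_mod_cast this

end Assembly

end NonKinematic

end Summit.HubbardSuperconductivity.HubbardSuperconductivity.Cruxes.GappedWindow.Birth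

end
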